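import Mathlib
import Literature.MathematicalPhysics.QuantumLattice.Imbrie2016.UmbilicPlanes

/-!
# The `B_F(1)′` chart of the three-spin block: cluster frame and the compression table

Finite algebraic facts (hypotheses (H1) and cleanliness of the 'free qubit ⊗ pair' template) at
the umbilic stratum `B_F(1)′` (branch `σ = +`) of the three-spin block,
[cite: ImbrieJSP2016, eq. (1.1), assumption LLA(ν, C)]  Repair cell b2b-imbrie, LLA.md block
Q8(c),(d), refereed in REFEREE.md G277, G278 (check (5)).
J. Z. Imbrie, *On many-body localization for quantum spin chains*,
J. Stat. Phys. 163 (2016) 998–1048, arXiv:1403.7837 (Theorem 1.1, Assumption LLA).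

At `b′(φ) ∈ B_F(1)′` (`h₃ = s`, `J₂ = s cos φ`, `t₂ = s sin φ`) the block Hamiltonian is
`H(b′) = s·(Z₃ + cos φ Z₂Z₃ + sin φ X₂)`; site 1 is the FREE QUBIT and `Z₃` is conserved.  In the
sector `Z₃ = s₃` the sites-2,3 operator is `s(s₃ + s₃ cos φ Z₂ + sin φ X₂)` with levels `s(s₃ ± 1)`,
so the zero level is the pair `χ₊ = lo₊ ⊗ |↑⟩₃`, `χ₋ = up₋ ⊗ |↓⟩₃` with, in half-angle parameters
`p = cos(φ/2)`, `q = sin(φ/2)` (`cos φ = p² − q²`, `sin φ = 2pq`), `lo₊ = (−q, p)` (eigenvalue `−1`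
of `cos φ Z + sin φ X`) and `up₋ = (q, p)` (eigenvalue `+1` of `−cos φ Z + sin φ X`).  The frame
`f i α = e_i ⊗ χ_α` is orthonormal (`frame_gram`), lies in `ker H(b′)` (`cluster_kernel`), and the
eight generators compress to `T = ℂ²₁ ⊗ span{χ₊, χ₋}` as
`Z₁ ↦ Z⊗1`, `X₁ ↦ X⊗1`, `Z₃ ↦ 1⊗τ_z` (the swept directions `h₁, t₁, h₃`: (H1)),
`Z₂ ↦ −cos φ·1`, `X₂ ↦ −sin φ·1⊗τ_z`, `Z₁Z₂ ↦ −cos φ·Z⊗1`, `Z₂Z₃ ↦ −cos φ·1⊗τ_z` (one-body), and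
`X₃ ↦ cos φ·1⊗τ_x` — the only `τ_x`-feed, along the frozen direction `t₃`, with the overlap
`⟨lo₊|up₋⟩ = p² − q² = cos φ` of G278 check (5); no generator has a `Z⊗τ` part (cleanliness).
The branch `σ = −` and the mirror stratum `B_F(3)′` follow by the symmetries `X₃`-conjugation and
`1 ↔ 3` of LLA.md Q8(d).  Kets as in `UmbilicPlanes`; everything is polynomial algebra in `p, q`.
-/

namespace Literature.MathematicalPhysics.QuantumLattice.Imbrie2016.ChartBF1prime

open UmbilicPlanes (Ket sgn transverse diag)

/-- [cite: ImbrieJSP2016, eq. (1.1)] `lo₊ = (−q, p)`: the `−1` eigenvector of `cos φ Z + sin φ X`. -/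
def lo (p q : ℝ) (b : Fin 2) : ℝ := if b = 0 then -q else p

/-- [cite: ImbrieJSP2016, eq. (1.1)] `up₋ = (q, p)`: the `+1` eigenvector of `−cos φ Z + sin φ X`. -/
def up (p q : ℝ) (b : Fin 2) : ℝ := if b = 0 then q else p

/-- [cite: ImbrieJSP2016, eq. (1.1)] The pair states `χ 0 = lo₊ ⊗ |↑⟩₃`, `χ 1 = up₋ ⊗ |↓⟩₃`
(sites 2, 3), both of energy `0`. -/
def chi (p q : ℝ) (α : Fin 2) (b c : Fin 2) : ℝ :=
  if α = 0 then lo p q b * (if c = 0 then 1 else 0) else up p q b * (if c = 1 then 1 else 0)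

/-- [cite: ImbrieJSP2016, eq. (1.1)] The cluster frame `f i α = e_i ⊗ χ_α` (free qubit = site 1). -/
def frame (p q : ℝ) (i α : Fin 2) : Ket :=
  fun a b c => (if a = i then 1 else 0) * chi p q α b c

/-- [cite: ImbrieJSP2016, eq. (1.1)] The frame is orthonormal. -/
theorem frame_gram (p q : ℝ) (hpq : p ^ 2 + q ^ 2 = 1) (i j α β : Fin 2) :
    UmbilicPlanes.inner (frame p q i α) (frame p q j β) = if i = j ∧ α = β then 1 else 0 := by
  fin_cases i <;> fin_cases j <;> fin_cases α <;> fin_cases β <;>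
    norm_num [UmbilicPlanes.inner, frame, chi, lo, up, Fin.sum_univ_two] <;> nlinarith [hpq]

/-- [cite: ImbrieJSP2016, eq. (1.1)] `T ⊆ ker H(b′)`: `H(b′) = s(Z₃ + cos φ Z₂Z₃ + sin φ X₂)`,
`cos φ = p² − q²`, `sin φ = 2pq`, annihilates every frame vector (any amplitude `s`). -/
theorem cluster_kernel (p q s : ℝ) (hpq : p ^ 2 + q ^ 2 = 1) (i α : Fin 2) :
    (fun a b c => diag 0 0 0 s 0 (s * (p ^ 2 - q ^ 2)) (frame p q i α) a b c
      + transverse 0 (s * (2 * p * q)) 0 (frame p q i α) a b c) = fun _ _ _ => (0 : ℝ) := by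
  funext a b c
  fin_cases i <;> fin_cases α <;> fin_cases a <;> fin_cases b <;> fin_cases c <;>
    norm_num [diag, UmbilicPlanes.landscape, transverse, frame, chi, lo, up, sgn, Fin.rev] <;>
    first
      | linear_combination (s * q) * hpq
      | linear_combination (-(s * q)) * hpq
      | linear_combination (s * p) * hpq
      | linear_combination (-(s * p)) * hpq

/-- [cite: ImbrieJSP2016, eq. (1.1)] `Z₁ ↦ Z ⊗ 1` on `T` (swept direction `h₁`). -/
theorem compress_Z1 (p q : ℝ) (hpq : p ^ 2 + q ^ 2 = 1) (i j α β : Fin 2) :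
    UmbilicPlanes.inner (frame p q i α) (diag 0 1 0 0 0 0 (frame p q j β))
      = if i = j ∧ α = β then sgn i else 0 := by
  fin_cases i <;> fin_cases j <;> fin_cases α <;> fin_cases β <;>
    norm_num [UmbilicPlanes.inner, diag, UmbilicPlanes.landscape, frame, chi, lo, up, sgn,
      Fin.sum_univ_two] <;> nlinarith [hpq]

/-- [cite: ImbrieJSP2016, eq. (1.1)] `X₁ ↦ X ⊗ 1` on `T` (swept direction `t₁`). -/
theorem compress_X1 (p q : ℝ) (hpq : p ^ 2 + q ^ 2 = 1) (i j α β : Fin 2) :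
    UmbilicPlanes.inner (frame p q i α) (transverse 1 0 0 (frame p q j β))
      = if i ≠ j ∧ α = β then 1 else 0 := by
  fin_cases i <;> fin_cases j <;> fin_cases α <;> fin_cases β <;>
    norm_num [UmbilicPlanes.inner, transverse, frame, chi, lo, up, sgn, Fin.sum_univ_two,
      Fin.rev] <;> nlinarith [hpq]

/-- [cite: ImbrieJSP2016, eq. (1.1)] `Z₃ ↦ 1 ⊗ τ_z` on `T` (swept direction `h₃`). -/
theorem compress_Z3 (p q : ℝ) (hpq : p ^ 2 + q ^ 2 = 1) (i j α β : Fin 2) :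
    UmbilicPlanes.inner (frame p q i α) (diag 0 0 0 1 0 0 (frame p q j β))
      = if i = j ∧ α = β then sgn α else 0 := by
  fin_cases i <;> fin_cases j <;> fin_cases α <;> fin_cases β <;>
    norm_num [UmbilicPlanes.inner, diag, UmbilicPlanes.landscape, frame, chi, lo, up, sgn,
      Fin.sum_univ_two] <;> nlinarith [hpq]

/-- [cite: ImbrieJSP2016, eq. (1.1)] `Z₂ ↦ −cos φ · 1` on `T` (scalar on the pair:
`⟨lo₊|Z|lo₊⟩ = ⟨up₋|Z|up₋⟩ = q² − p²`). -/
theorem compress_Z2 (p q : ℝ) (i j α β : Fin 2) :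
    UmbilicPlanes.inner (frame p q i α) (diag 0 0 1 0 0 0 (frame p q j β))
      = if i = j ∧ α = β then -(p ^ 2 - q ^ 2) else 0 := by
  fin_cases i <;> fin_cases j <;> fin_cases α <;> fin_cases β <;>
    norm_num [UmbilicPlanes.inner, diag, UmbilicPlanes.landscape, frame, chi, lo, up, sgn,
      Fin.sum_univ_two] <;> ring

/-- [cite: ImbrieJSP2016, eq. (1.1)] `X₂ ↦ −sin φ · 1 ⊗ τ_z` on `T` (one-body). -/
theorem compress_X2 (p q : ℝ) (i j α β : Fin 2) :
    UmbilicPlanes.inner (frame p q i α) (transverse 0 1 0 (frame p q j β))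
      = if i = j ∧ α = β then -(2 * p * q) * sgn α else 0 := by
  fin_cases i <;> fin_cases j <;> fin_cases α <;> fin_cases β <;>
    norm_num [UmbilicPlanes.inner, transverse, frame, chi, lo, up, sgn, Fin.sum_univ_two,
      Fin.rev] <;> ring

/-- [cite: ImbrieJSP2016, eq. (1.1)] `Z₁Z₂ ↦ −cos φ · Z ⊗ 1` on `T` (one-body). -/
theorem compress_Z1Z2 (p q : ℝ) (i j α β : Fin 2) :
    UmbilicPlanes.inner (frame p q i α) (diag 0 0 0 0 1 0 (frame p q j β))
      = if i = j ∧ α = β then -(p ^ 2 - q ^ 2) * sgn i else 0 := by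
  fin_cases i <;> fin_cases j <;> fin_cases α <;> fin_cases β <;>
    norm_num [UmbilicPlanes.inner, diag, UmbilicPlanes.landscape, frame, chi, lo, up, sgn,
      Fin.sum_univ_two] <;> ring

/-- [cite: ImbrieJSP2016, eq. (1.1)] `Z₂Z₃ ↦ −cos φ · 1 ⊗ τ_z` on `T` (one-body). -/
theorem compress_Z2Z3 (p q : ℝ) (i j α β : Fin 2) :
    UmbilicPlanes.inner (frame p q i α) (diag 0 0 0 0 0 1 (frame p q j β))
      = if i = j ∧ α = β then -(p ^ 2 - q ^ 2) * sgn α else 0 := by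
  fin_cases i <;> fin_cases j <;> fin_cases α <;> fin_cases β <;>
    norm_num [UmbilicPlanes.inner, diag, UmbilicPlanes.landscape, frame, chi, lo, up, sgn,
      Fin.sum_univ_two] <;> ring

/-- [cite: ImbrieJSP2016, eq. (1.1), assumption LLA(ν, C)] `X₃ ↦ cos φ · 1 ⊗ τ_x` on `T`
(`⟨lo₊|up₋⟩ = p² − q² = cos φ`, G278 check (5)): the ONLY `τ_x`-feed among the eight generators,
along the frozen direction `t₃`; no generator has a `Z ⊗ τ` part (cleanliness). -/
theorem compress_X3 (p q : ℝ) (i j α β : Fin 2) :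
    UmbilicPlanes.inner (frame p q i α) (transverse 0 0 1 (frame p q j β))
      = if i = j ∧ α ≠ β then p ^ 2 - q ^ 2 else 0 := by
  fin_cases i <;> fin_cases j <;> fin_cases α <;> fin_cases β <;>
    norm_num [UmbilicPlanes.inner, transverse, frame, chi, lo, up, sgn, Fin.sum_univ_two,
      Fin.rev] <;> ring

end Literature.MathematicalPhysics.QuantumLattice.Imbrie2016.ChartBF1prime
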